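import Mathlib
import HarnessLib
import Summits.CriticalPhenomena.CardyFormulaZ2.Theorems.CardyMagicRigidityMagicFormulaTExistsLimit
import Summits.CriticalPhenomena.CardyFormulaZ2.Theorems.CardyMagicRigidityMagicFormulaTAprioriBounds
import Summits.CriticalPhenomena.CardyFormulaZ2.Theorems.CardyMagicRigidityMagicFormulaTRibbonRarity
import Summits.CriticalPhenomena.CardyFormulaZ2.Theorems.CardyMagicRigidityMagicFormulaTExistsLimitA1sqUV
import Summits.CriticalPhenomena.CardyFormulaZ2.Theorems.CardyMagicRigidityMagicFormulaTExistsLimitA1sqComparison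

/-!
# Existence of `lim_δ E_{1/2}[A₁²]` modulo CN + SW — part 3/3: the Cauchy argument
(crux `MagicFormulaT`, line `Sketch` v10, registered sub-goal `el_existsLimitA1sq_of_facts`)

Crux `Summit.CriticalPhenomena.CardyFormulaZ2.Theses.CardyMagicRigidity.MagicFormulaT`
(stmt-CriticalPhenomena-4836), line `Sketch`, skeleton v10 (lead c4), wave 5, registered sub-goal
`el_existsLimitA1sq_of_facts`: modulo Camia–Newman (`exists_isFullPlaneCNLLaw`, in its Cauchy form
`cnLawEDist_siteLoopConfig_le`) and Smirnov–Werner (`SmirnovWerner2001_fourArm_scalingLimit`, through the ribbon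
bound `stub_ribbonRarity`), for every admissible density `f` the limit of `E_{1/2}[A₁²]`, `A₁ = Σ_u θ_u`
(`θ_u = u.nestingPhase f`, loops of `siteLoopConfig δ ω` under `triSitePercolation half`), EXISTS as `δ → 0⁺`.

Proof: lead c3's Cauchy argument for `Λ_δ(f)` (`stub_existsLimit`, v7.1) run for the functional `A₁²`.  Fix `κ > 0`,
`κ₁ = κ/10`.  (UV, part 1/3 `ela1_uv`) there are `η ≤ 1`, `B`, `δ_U` with, for every `m ≥ 1` and `δ ≤ min(δ_U, η/2)`,
`|E A₁² − E X̄²| ≤ κ₁`, `E X̄⁴ ≤ B`, where `X̄ = m⁻¹ Σ_{j<m} Σ_{u ∈ bigLoops η_j} θ_u` is the threshold average of the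
big-loop phase sums, `η_j = η/2 + (j+1)η/(2m)`.  Put `p₀ = κ₁²/(2(4B+1))`; take `N₀` from the count tightness
(`stub_aprioriBounds` (ii)) at `(R+1, η/5, p₀/10)`, then `m` and `τ` with `2N₀²K(Cτ + 2πCη²/m) ≤ κ₁`
(`K = C·Leb B̄(0,R)`), then the sausage scale, the ribbon scale (`stub_ribbonRarity hSW`), the window, and the closeness
scale `ε` exactly as c3.  For two meshes `δ, δ'` below all thresholds couple the configurations by `Q` with marginals
`P` at `d_CN`-distance `< ε` (CN + `exists_coupling_of_cnLawEDist_lt`); off the bad set (not `ε`-close, or a marginal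
bad event: too many relevant loops, a loop leaving the window, a fat sausage, a ribbon) the deterministic comparison
`ela1_comparison` (part 2/3) gives `|X̄_δ² − X̄_{δ'}²| ≤ κ₁`, the bad set has `Q`-outer measure `≤ p₀`, and the
abstract coupling estimate `el_coupling_estimate` (with `F = X̄_δ²`, `G = X̄_{δ'}²`, second moments `≤ B`) gives
`|E X̄_δ² − E X̄_{δ'}²| ≤ 2κ₁`; with the two UV errors, `|E_δ A₁² − E_{δ'} A₁²| ≤ 4κ₁ ≤ κ`, and Cauchy families
converge (`el_exists_tendsto_of_cauchy`).  No definition, no cited fact.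
-/

noncomputable section

namespace Summit.CriticalPhenomena.CardyFormulaZ2.Cruxes.MagicFormulaT.LineSketch

open MeasureTheory Filter Set
open scoped Real Topology BigOperators ENNReal
open Literature.Probability.RandomPlanarGeometry Literature.Probability.Percolation
  Literature.Probability.LatticeModels

/-- **Sub-goal EL-A1² (`el_existsLimitA1sq_of_facts`, registered, verbatim signature): modulo Camia–Newman and
Smirnov–Werner, `lim_{δ→0⁺} E_{1/2}[A₁²]` exists for every admissible density** — Cauchy argument through the CN
coupling, the a priori bounds, the ribbon bound, the deterministic comparison of the squared threshold-averaged
big-loop phase sums and the UV step; see the module docstring. -/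
theorem el_existsLimitA1sq_of_facts : exists_isFullPlaneCNLLaw → SmirnovWerner2001_fourArm_scalingLimit →
    ∀ (f : ℂ → ℝ) (R C : ℝ), Measurable f → (∀ z, |f z| ≤ C) → (∀ z, R < ‖z‖ → f z = 0) → ∫ z, f z = 0 →
    ∃ L : ℝ, Tendsto (fun δ : ℝ ↦ ∫ ω, (∑ᶠ u ∈ (siteLoopConfig δ ω).loops, u.nestingPhase f) ^ 2
      ∂(triSitePercolation half)) (𝓝[>] (0 : ℝ)) (𝓝 L) := by
  intro hCN hSW f R C hf hC hR h0
  obtain ⟨-, hA2, hA3, hA4⟩ := stub_aprioriBounds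
  have hRib := stub_ribbonRarity hSW
  set P : Measure (SiteConfig (Site 2)) := triSitePercolation half with hPdef
  apply el_exists_tendsto_of_cauchy
  intro κ hκ
  set κ₁ : ℝ := κ / 10 with hκ₁def
  have hκ₁ : 0 < κ₁ := by positivity
  have hκ4 : κ₁ + 2 * κ₁ + κ₁ ≤ κ := by rw [hκ₁def]; linarith
  have hC0 : 0 ≤ C := nonneg_of_abs_le hC
  -- (UV) and the uniform moments (part 1/3)
  obtain ⟨η, B, δU, hη, hη1, hB, hδU, hUV⟩ := ela1_uv f R C hf hC hR h0 κ₁ hκ₁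
  set p₀ : ℝ := κ₁ ^ 2 / (2 * (4 * B + 1)) with hp₀def
  have hp₀ : 0 < p₀ := by positivity
  -- (A)(ii): tightness of the number of relevant loops
  obtain ⟨N₀, δN, hδN, hN⟩ := hA2 (R + 1) (η / 5) (p₀ / 10) (by positivity) (by positivity)
  -- the phase bound `K`, the comparison constant `L`, the number of thresholds `m`, the sausage tolerance `τ`
  set K : ℝ := C * volume.real (Metric.closedBall (0 : ℂ) R) with hKdef
  have hK0 : 0 ≤ K := mul_nonneg hC0 measureReal_nonneg
  set L : ℝ := 2 * (N₀ : ℝ) ^ 2 * K with hLdef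
  have hL0 : 0 ≤ L := by positivity
  set K' : ℝ := L * (2 * π * C * η ^ 2) with hK'def
  have hK'0 : 0 ≤ K' := by positivity
  set m : ℕ := ⌈2 * K' / κ₁⌉₊ + 1 with hmdef
  have hm1 : 1 ≤ m := Nat.le_add_left 1 _
  have hmpos : (0 : ℝ) < m := by exact_mod_cast hm1
  have hmK : L * (2 * π * C * η ^ 2 / m) ≤ κ₁ / 2 := by
    have h1 : 2 * K' / κ₁ ≤ m := by
      rw [hmdef]; push_cast
      exact (Nat.le_ceil _).trans (le_add_of_nonneg_right zero_le_one)
    have h2 : 2 * K' ≤ κ₁ * m := by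
      have := (div_le_iff₀ hκ₁).1 h1
      linarith
    have h3 : L * (2 * π * C * η ^ 2 / m) = K' / m := by rw [hK'def]; ring
    rw [h3, div_le_iff₀ hmpos]
    linarith
  set τ : ℝ := κ₁ / 2 / (L * C + 1) with hτdef
  have hτ : 0 < τ := by positivity
  have hτK : L * (C * τ) ≤ κ₁ / 2 := by
    have hx : 0 ≤ L * C := by positivity
    have h1 : L * C / (L * C + 1) ≤ 1 := (div_le_one (by positivity)).2 (by linarith)
    have h2 : L * (C * τ) = κ₁ / 2 * (L * C / (L * C + 1)) := by
      rw [hτdef]; field_simp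
    rw [h2]
    calc κ₁ / 2 * (L * C / (L * C + 1)) ≤ κ₁ / 2 * 1 := mul_le_mul_of_nonneg_left h1 (by positivity)
      _ = κ₁ / 2 := mul_one _
  have hcmpBound : L * (C * τ + 2 * π * C * η ^ 2 / m) ≤ κ₁ := by
    rw [mul_add]; linarith
  obtain ⟨εS, hεS, hS⟩ := hA4 R (η / 5) τ (p₀ / 10) (by positivity) hτ (by positivity)
  obtain ⟨εR, hεR, hRb⟩ := hRib (R + 1) (η / 5) (p₀ / 10) (by positivity) (by positivity)
  obtain ⟨D, δW, hD, hδW, hW⟩ := hA3 (R + 1) (p₀ / 10) (by positivity)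
  -- the closeness scale `ε`
  set ε : ℝ := min (min (min εS εR) (min (1 / D) (η / (8 * m)))) (min 1 (p₀ / 10)) with hεdef
  have hε : 0 < ε := by positivity
  have hεS' : ε ≤ εS := by rw [hεdef]; exact (min_le_left _ _).trans ((min_le_left _ _).trans (min_le_left _ _))
  have hεR' : ε ≤ εR := by rw [hεdef]; exact (min_le_left _ _).trans ((min_le_left _ _).trans (min_le_right _ _))
  have hεD : ε ≤ 1 / D := by rw [hεdef]; exact (min_le_left _ _).trans ((min_le_right _ _).trans (min_le_left _ _))
  have hεm : ε ≤ η / (8 * m) := by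
    rw [hεdef]; exact (min_le_left _ _).trans ((min_le_right _ _).trans (min_le_right _ _))
  have hε1 : ε ≤ 1 := by rw [hεdef]; exact (min_le_right _ _).trans (min_le_left _ _)
  have hεp : ε ≤ p₀ / 10 := by rw [hεdef]; exact (min_le_right _ _).trans (min_le_right _ _)
  have h8m : 8 * m * ε ≤ η := by
    have := mul_le_mul_of_nonneg_left hεm (by positivity : (0 : ℝ) ≤ 8 * m)
    calc 8 * m * ε ≤ 8 * m * (η / (8 * m)) := this
      _ = η := by field_simp
  obtain ⟨δS, hδS, hS'⟩ := hS ε hε hεS'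
  obtain ⟨δR, hδR, hR'⟩ := hRb ε hε hεR'
  -- (CN): couplings at scale `ε/2`
  have hCNev := hCN.cnLawEDist_siteLoopConfig_le (η := ENNReal.ofReal (ε / 2))
    (ENNReal.ofReal_pos.2 (half_pos hε))
  rw [Filter.eventually_prod_iff] at hCNev
  obtain ⟨pa, hpa, pb, hpb, hprod⟩ := hCNev
  obtain ⟨δa, hδa, ha⟩ := el_exists_Ioo_of_eventually hpa
  obtain ⟨δb, hδb, hb⟩ := el_exists_Ioo_of_eventually hpb
  refine ⟨min (min (min δU (η / 2)) (min δN (min δS δR))) (min δW (min δa δb)), by positivity, ?_⟩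
  intro δ δ' hδ hδlt hδ' hδ'lt
  -- unpack the mesh bounds
  have hlt : ∀ {x : ℝ}, x < min (min (min δU (η / 2)) (min δN (min δS δR))) (min δW (min δa δb)) →
      x < δU ∧ x < η / 2 ∧ x < δN ∧ x < δS ∧ x < δR ∧ x < δW ∧ x < δa ∧ x < δb := by
    intro x hx
    simp only [lt_min_iff] at hx
    exact ⟨hx.1.1.1, hx.1.1.2, hx.1.2.1, hx.1.2.2.1, hx.1.2.2.2, hx.2.1, hx.2.2.1, hx.2.2.2⟩
  obtain ⟨h1U, h1η, h1N, h1S, h1R, h1W, h1a, -⟩ := hlt hδlt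
  obtain ⟨h2U, h2η, h2N, -, h2R, h2W, -, h2b⟩ := hlt hδ'lt
  -- the coupling
  have hdist : LoopConfig.cnLawEDist P (siteLoopConfig δ) P (siteLoopConfig δ') < ENNReal.ofReal ε := by
    have h := hprod (ha δ hδ h1a) (hb δ' hδ' h2b)
    refine lt_of_le_of_lt h ?_
    exact (ENNReal.ofReal_lt_ofReal_iff hε).2 (by linarith)
  obtain ⟨Q, hQ1, hQ2, hQbad⟩ := LoopConfig.exists_coupling_of_cnLawEDist_lt hdist
  -- the bad sets
  set Sc : ℝ → Set (SiteConfig (Site 2)) := fun d ↦ {ω | ¬ ({u ∈ (siteLoopConfig d ω).loops |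
      (u.range ∩ Metric.closedBall (0 : ℂ) (R + 1)).Nonempty ∧ η / 5 ≤ Metric.diam u.range}.Finite ∧
    {u ∈ (siteLoopConfig d ω).loops |
      (u.range ∩ Metric.closedBall (0 : ℂ) (R + 1)).Nonempty ∧ η / 5 ≤ Metric.diam u.range}.ncard ≤ N₀)}
    with hScdef
  set Sw : ℝ → Set (SiteConfig (Site 2)) := fun d ↦ {ω | ∃ u ∈ (siteLoopConfig d ω).loops,
      (u.range ∩ Metric.closedBall (0 : ℂ) (R + 1)).Nonempty ∧ ¬ (u.range ⊆ Metric.ball (0 : ℂ) D)}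
    with hSwdef
  set Ss : ℝ → Set (SiteConfig (Site 2)) := fun d ↦ {ω | ∃ u ∈ (siteLoopConfig d ω).loops,
      (u.range ∩ Metric.closedBall (0 : ℂ) (R + 1)).Nonempty ∧ η / 5 ≤ Metric.diam u.range ∧
      τ < volume.real ({z : ℂ | Metric.infDist z u.range ≤ ε} ∩ Metric.closedBall (0 : ℂ) R)}
    with hSsdef
  set Sr : ℝ → Set (SiteConfig (Site 2)) := fun d ↦ {ω | ∃ u ∈ (siteLoopConfig d ω).loops,
      ∃ v ∈ (siteLoopConfig d ω).loops,
      u ≠ v ∧ (u.range ∩ Metric.closedBall (0 : ℂ) (R + 1)).Nonempty ∧ η / 5 ≤ Metric.diam u.range ∧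
      η / 5 ≤ Metric.diam v.range ∧ u.udist v ≤ 2 * ε} with hSrdef
  have hPc : ∀ d, 0 < d → d < δN → P (Sc d) ≤ ENNReal.ofReal (p₀ / 10) := fun d hd hdN ↦ hN d hd hdN.le
  have hPw : ∀ d, 0 < d → d < δW → P (Sw d) ≤ ENNReal.ofReal (p₀ / 10) := fun d hd hdW ↦ hW d hd hdW.le
  have hPs : P (Ss δ) ≤ ENNReal.ofReal (p₀ / 10) := hS' δ hδ h1S.le
  have hPr : ∀ d, 0 < d → d < δR → P (Sr d) ≤ ENNReal.ofReal (p₀ / 10) := fun d hd hdR ↦ hR' d hd hdR.le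
  set Bad0 : Set (SiteConfig (Site 2) × SiteConfig (Site 2)) :=
    {p | ¬ LoopConfig.IsClose ε (siteLoopConfig δ p.1) (siteLoopConfig δ' p.2)} ∪
      (Prod.fst ⁻¹' (Sc δ ∪ Sw δ ∪ Ss δ ∪ Sr δ) ∪ Prod.snd ⁻¹' (Sc δ' ∪ Sw δ' ∪ Sr δ')) with hBad0def
  have hBad : Q Bad0 ≤ ENNReal.ofReal (κ₁ ^ 2 / (2 * (4 * B + 1))) := by
    have hp10 : (0 : ℝ) ≤ p₀ / 10 := by positivity
    have e2 : ENNReal.ofReal (p₀ / 10) + ENNReal.ofReal (p₀ / 10) = ENNReal.ofReal (2 * (p₀ / 10)) := by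
      rw [← ENNReal.ofReal_add hp10 hp10]; congr 1; ring
    have e3 : ENNReal.ofReal (2 * (p₀ / 10)) + ENNReal.ofReal (p₀ / 10) = ENNReal.ofReal (3 * (p₀ / 10)) := by
      rw [← ENNReal.ofReal_add (by positivity) hp10]; congr 1; ring
    have e4 : ENNReal.ofReal (3 * (p₀ / 10)) + ENNReal.ofReal (p₀ / 10) = ENNReal.ofReal (4 * (p₀ / 10)) := by
      rw [← ENNReal.ofReal_add (by positivity) hp10]; congr 1; ring
    have hfst : Q (Prod.fst ⁻¹' (Sc δ ∪ Sw δ ∪ Ss δ ∪ Sr δ)) ≤ ENNReal.ofReal (4 * (p₀ / 10)) := by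
      refine (Measure.le_map_apply measurable_fst.aemeasurable _).trans ?_
      rw [hQ1]
      have u1 : P (Sc δ ∪ Sw δ ∪ Ss δ ∪ Sr δ) ≤ P (Sc δ ∪ Sw δ ∪ Ss δ) + P (Sr δ) :=
        measure_union_le (μ := P) (Sc δ ∪ Sw δ ∪ Ss δ) (Sr δ)
      have u2 : P (Sc δ ∪ Sw δ ∪ Ss δ) ≤ P (Sc δ ∪ Sw δ) + P (Ss δ) :=
        measure_union_le (μ := P) (Sc δ ∪ Sw δ) (Ss δ)
      have u3 : P (Sc δ ∪ Sw δ) ≤ P (Sc δ) + P (Sw δ) := measure_union_le (μ := P) (Sc δ) (Sw δ)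
      have v1 := hPc δ hδ h1N
      have v2 := hPw δ hδ h1W
      have v4 := hPr δ hδ h1R
      calc P (Sc δ ∪ Sw δ ∪ Ss δ ∪ Sr δ)
          ≤ ((ENNReal.ofReal (p₀ / 10) + ENNReal.ofReal (p₀ / 10)) + ENNReal.ofReal (p₀ / 10)) +
              ENNReal.ofReal (p₀ / 10) := by
            calc P (Sc δ ∪ Sw δ ∪ Ss δ ∪ Sr δ) ≤ P (Sc δ ∪ Sw δ ∪ Ss δ) + P (Sr δ) := u1
              _ ≤ (P (Sc δ ∪ Sw δ) + P (Ss δ)) + P (Sr δ) := add_le_add u2 le_rfl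
              _ ≤ ((P (Sc δ) + P (Sw δ)) + P (Ss δ)) + P (Sr δ) := add_le_add (add_le_add u3 le_rfl) le_rfl
              _ ≤ _ := add_le_add (add_le_add (add_le_add v1 v2) hPs) v4
        _ = ENNReal.ofReal (4 * (p₀ / 10)) := by rw [e2, e3, e4]
    have hsnd : Q (Prod.snd ⁻¹' (Sc δ' ∪ Sw δ' ∪ Sr δ')) ≤ ENNReal.ofReal (3 * (p₀ / 10)) := by
      refine (Measure.le_map_apply measurable_snd.aemeasurable _).trans ?_
      rw [hQ2]
      have u2 : P (Sc δ' ∪ Sw δ' ∪ Sr δ') ≤ P (Sc δ' ∪ Sw δ') + P (Sr δ') :=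
        measure_union_le (μ := P) (Sc δ' ∪ Sw δ') (Sr δ')
      have u3 : P (Sc δ' ∪ Sw δ') ≤ P (Sc δ') + P (Sw δ') := measure_union_le (μ := P) (Sc δ') (Sw δ')
      have v1 := hPc δ' hδ' h2N
      have v2 := hPw δ' hδ' h2W
      have v4 := hPr δ' hδ' h2R
      calc P (Sc δ' ∪ Sw δ' ∪ Sr δ')
          ≤ (ENNReal.ofReal (p₀ / 10) + ENNReal.ofReal (p₀ / 10)) + ENNReal.ofReal (p₀ / 10) := by
            calc P (Sc δ' ∪ Sw δ' ∪ Sr δ') ≤ P (Sc δ' ∪ Sw δ') + P (Sr δ') := u2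
              _ ≤ (P (Sc δ') + P (Sw δ')) + P (Sr δ') := add_le_add u3 le_rfl
              _ ≤ _ := add_le_add (add_le_add v1 v2) v4
        _ = ENNReal.ofReal (3 * (p₀ / 10)) := by rw [e2, e3]
    have htot : Q Bad0 ≤ ENNReal.ofReal ε + (ENNReal.ofReal (4 * (p₀ / 10)) + ENNReal.ofReal (3 * (p₀ / 10))) :=
      (measure_union_le _ _).trans (add_le_add hQbad.le ((measure_union_le _ _).trans (add_le_add hfst hsnd)))
    have e5 : ENNReal.ofReal ε + (ENNReal.ofReal (4 * (p₀ / 10)) + ENNReal.ofReal (3 * (p₀ / 10))) =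
        ENNReal.ofReal (ε + (4 * (p₀ / 10) + 3 * (p₀ / 10))) := by
      rw [← ENNReal.ofReal_add (by positivity) (by positivity), ← ENNReal.ofReal_add hε.le (by positivity)]
    rw [e5] at htot
    refine htot.trans (ENNReal.ofReal_le_ofReal ?_)
    rw [← hp₀def]; linarith
  -- the second power sums and the squared averaged big-loop sums
  set A : ℝ → SiteConfig (Site 2) → ℝ := fun d ω ↦
    ∑ᶠ u ∈ (siteLoopConfig d ω).loops, u.nestingPhase f with hAdef
  set Xbar : ℝ → SiteConfig (Site 2) → ℝ := fun d ω ↦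
    (∑ j ∈ Finset.range m, ∑ᶠ u ∈ (siteLoopConfig d ω).bigLoops (η / 2 + ((j : ℝ) + 1) * η / (2 * m)),
      u.nestingPhase f) / m with hXbardef
  have hprops : ∀ d : ℝ, 0 < d → d < δU → d < η / 2 →
      Measurable (fun ω ↦ Xbar d ω ^ 2) ∧ Integrable (fun ω ↦ Xbar d ω ^ 2) P ∧
        Integrable (fun ω ↦ (Xbar d ω ^ 2) ^ 2) P ∧ ∫ ω, (Xbar d ω ^ 2) ^ 2 ∂P ≤ B ∧
        |∫ ω, A d ω ^ 2 ∂P - ∫ ω, Xbar d ω ^ 2 ∂P| ≤ κ₁ := by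
    intro d hd hdU hdη
    obtain ⟨-, hI2, hI4, hE4, hdiff⟩ := hUV η m d hη le_rfl hm1 hd hdU.le hdη.le
    exact ⟨(ela1_measurable_avg f d η m).pow_const 2, hI2, hI4, hE4, hdiff⟩
  obtain ⟨hM1, hI1, hI21, hEB1, hUV1⟩ := hprops δ hδ h1U h1η
  obtain ⟨hM2, hI2, hI22, hEB2, hUV2⟩ := hprops δ' hδ' h2U h2η
  -- on the good set the comparison applies
  have hgood : ∀ p, p ∉ Bad0 → |Xbar δ p.1 ^ 2 - Xbar δ' p.2 ^ 2| ≤ κ₁ := by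
    intro p hp
    have hu : ∀ {α : Type} {s t : Set α} {x : α}, x ∉ s ∪ t → x ∉ s ∧ x ∉ t :=
      fun h ↦ ⟨fun hs ↦ h (Or.inl hs), fun ht ↦ h (Or.inr ht)⟩
    rw [hBad0def] at hp
    obtain ⟨hclose, hrest⟩ := hu hp
    obtain ⟨hp1, hp2⟩ := hu hrest
    have hp1' : p.1 ∉ Sc δ ∪ Sw δ ∪ Ss δ ∪ Sr δ := hp1
    have hp2' : p.2 ∉ Sc δ' ∪ Sw δ' ∪ Sr δ' := hp2
    obtain ⟨h123, hr1⟩ := hu hp1'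
    obtain ⟨h12, hs1⟩ := hu h123
    obtain ⟨hc1, hw1⟩ := hu h12
    obtain ⟨h12', hr2⟩ := hu hp2'
    obtain ⟨hc2, hw2⟩ := hu h12'
    have hclose' : LoopConfig.IsClose ε (siteLoopConfig δ p.1) (siteLoopConfig δ' p.2) := not_not.1 hclose
    simp only [hScdef, Set.mem_setOf_eq, not_not] at hc1 hc2
    simp only [hSwdef, Set.mem_setOf_eq, not_exists, not_and, not_not] at hw1 hw2
    simp only [hSsdef, Set.mem_setOf_eq, not_exists, not_and, not_lt] at hs1
    simp only [hSrdef, Set.mem_setOf_eq, not_exists, not_and, not_le] at hr1 hr2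
    have hballD : Metric.ball (0 : ℂ) D ⊆ Metric.ball 0 (1 / ε) := by
      refine Metric.ball_subset_ball ?_
      have := hεD
      rwa [le_one_div hε hD] at this
    have key := ela1_comparison f R C hf hC hR h0 (siteLoopConfig δ p.1) (siteLoopConfig δ' p.2) ε η τ m N₀
      hε hε1 hη h8m hτ.le hclose' hc1 hc2
      (fun u hu hmeet _ ↦ (hw1 u hu hmeet).trans hballD)
      (fun u hu hmeet _ ↦ (hw2 u hu hmeet).trans hballD)
      (fun u hu v hv hmu _ hdu hdv huv ↦ hr1 u hu v hv huv hmu hdu hdv)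
      (fun u hu v hv hmu _ hdu hdv huv ↦ hr2 u hu v hv huv hmu hdu hdv)
      (fun u hu hmeet hdu ↦ hs1 u hu hmeet hdu)
    exact key.trans hcmpBound
  -- the coupling estimate
  have hmid := el_coupling_estimate (P := P) (Q := Q) (F := fun ω ↦ Xbar δ ω ^ 2) (G := fun ω ↦ Xbar δ' ω ^ 2)
    hM1 hM2 hI1 hI2 hI21 hI22 hEB1 hEB2 hB.le hκ₁ hQ1 hQ2 hBad hgood
  -- conclusion
  rw [abs_sub_comm] at hUV2
  calc |∫ ω, A δ ω ^ 2 ∂P - ∫ ω, A δ' ω ^ 2 ∂P|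
      ≤ |∫ ω, A δ ω ^ 2 ∂P - ∫ ω, Xbar δ ω ^ 2 ∂P| +
          |∫ ω, Xbar δ ω ^ 2 ∂P - ∫ ω, Xbar δ' ω ^ 2 ∂P| +
          |∫ ω, Xbar δ' ω ^ 2 ∂P - ∫ ω, A δ' ω ^ 2 ∂P| :=
        (abs_sub_le _ _ _).trans (add_le_add (abs_sub_le _ _ _) le_rfl)
    _ ≤ κ₁ + 2 * κ₁ + κ₁ := add_le_add (add_le_add hUV1 hmid) hUV2
    _ ≤ κ := hκ4

end Summit.CriticalPhenomena.CardyFormulaZ2.Cruxes.MagicFormulaT.LineSketch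

end
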